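import Summits.Ventures.PercRepro.Night2T3Sizes

/-!
# PercRepro — the type-`3` balance at corank `≤ 3` (night-2, NIGHT-2-t3.md §7 (5), the case `d ≤ 3`)

In the size form of the balance (`Jq_three_nonneg_of_sizes`) a rank-`q` set `G` with `|G| ≤ q + 3` has every term
`|G| + q − 3 − 2|S| = 2|G ∖ S| − (|G| − q) − 3` at least `−6 ≥ −(q + 2)` when `|G ∖ S| ≤ 2` — and such an `S` is
demand-free (`ρ(G ∖ S) ≤ |G ∖ S| ≤ 2`), so it is paid by the `(q + 2)·DF_3` term — and at least `0` when `|G ∖ S| ≥ 3`.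
Hence **`0 ≤ J_3(G)` for every rank-`q` set `G` of a simple matroid with `4 ≤ q` and `|G| ≤ q + 3`**, every `q`: the
corank-`≤ 3` case of the type-`3` layer with no bound on `q` (the coloop-free part may have `q + 3` points, outside the
census).  Imports `Night2T3Sizes` only.
-/
namespace PercRepro.Star

open Finset ThmH SixFour GenQ

variable {α : Type*} [DecidableEq α] {M : Matroid α} [M.Finite]

/-- A rank-`q` subset whose complement in `G` has at most two points is demand-free at type `3`. -/
theorem card_filter_sdiff_le_two_le_DFq (G : Finset α) (q : ℕ) :
    ((Rq M G q).filter (fun S : Finset α => (G \ S).card ≤ 2)).card ≤ DFq M G q 3 := by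
  unfold DFq
  apply Finset.card_le_card
  intro S hS
  rw [Finset.mem_filter] at hS ⊢
  refine ⟨hS.1, ?_⟩
  have h1 : M.eRk ((G \ S : Finset α) : Set α) ≤ ((G \ S).card : ℕ∞) := by
    have := M.eRk_le_encard ((G \ S : Finset α) : Set α)
    rwa [Set.encard_coe_eq_coe_finsetCard] at this
  have h2 : ((G \ S).card : ℕ∞) ≤ (2 : ℕ∞) := by exact_mod_cast hS.2
  calc M.eRk ((G \ S : Finset α) : Set α) + 1 ≤ (2 : ℕ∞) + 1 := by gcongr; exact h1.trans h2
    _ = ((3 : ℕ) : ℕ∞) := by norm_num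

/-- **The type-`3` balance at corank `≤ 3`**: on a simple matroid, `0 ≤ J_3(G)` for every rank-`q` set `G` with
`4 ≤ q` and `|G| ≤ q + 3`. -/
theorem Jq_three_nonneg_of_card_le_add_three (hs : Simple M) {G : Finset α} {q : ℕ} (hG : G ⊆ gr M)
    (hrG : M.eRk (G : Set α) = (q : ℕ∞)) (hq : 4 ≤ q) (hcard : G.card ≤ q + 3) : 0 ≤ Jq M G q 3 := by
  apply Jq_three_nonneg_of_sizes hs hG hrG (by omega)
  -- every term is at least `−(q + 2)·[|G ∖ S| ≤ 2]`
  have hterm : ∀ S ∈ Rq M G q,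
      (if (G \ S).card ≤ 2 then -((q : ℚ) + 2) else 0) ≤
        ((G.card : ℚ) + (q : ℚ) - 3 - 2 * (S.card : ℚ)) := by
    intro S hS
    have hS' := mem_Rq.1 hS
    have hsub : S ⊆ G := hS'.1
    have hSq : q ≤ S.card := le_card_of_eRk_eq hS'.2
    have hsd : (G \ S).card = G.card - S.card := Finset.card_sdiff_of_subset hsub
    have hle : S.card ≤ G.card := Finset.card_le_card hsub
    have hcast : (S.card : ℚ) = (G.card : ℚ) - ((G \ S).card : ℚ) := by
      rw [hsd]
      push_cast [hle]
      ring
    rw [hcast]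
    split_ifs with h
    · have hq' : (4 : ℚ) ≤ (q : ℚ) := by exact_mod_cast hq
      have hc' : (G.card : ℚ) ≤ (q : ℚ) + 3 := by exact_mod_cast hcard
      have hj : (0 : ℚ) ≤ ((G \ S).card : ℚ) := by positivity
      linarith
    · push Not at h
      have hj : (3 : ℚ) ≤ ((G \ S).card : ℚ) := by exact_mod_cast h
      have hc' : (G.card : ℚ) ≤ (q : ℚ) + 3 := by exact_mod_cast hcard
      linarith
  have hsum := Finset.sum_le_sum hterm
  have hleft : ∑ S ∈ Rq M G q, (if (G \ S).card ≤ 2 then -((q : ℚ) + 2) else 0) =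
      -((q : ℚ) + 2) * (((Rq M G q).filter (fun S : Finset α => (G \ S).card ≤ 2)).card : ℚ) := by
    rw [Finset.sum_ite, Finset.sum_const, Finset.sum_const_zero, add_zero, nsmul_eq_mul]
    ring
  have hDF : (((Rq M G q).filter (fun S : Finset α => (G \ S).card ≤ 2)).card : ℚ) ≤ (DFq M G q 3 : ℚ) := by
    exact_mod_cast card_filter_sdiff_le_two_le_DFq (M := M) (G := G) (q := q)
  have hq2 : (0 : ℚ) ≤ (q : ℚ) + 2 := by positivity
  rw [hleft] at hsum
  nlinarith [mul_le_mul_of_nonneg_left hDF hq2]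

end PercRepro.Star
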